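import Mathlib
import Summits.KontsevichZagierPeriods.Zeta5Search.LawWClassBoundThree
import Summits.KontsevichZagierPeriods.Zeta5Search.CVBlockReductionMixed
import HarnessLib

/-!
# ζ(5) search — the MIXED-PAIR BOUND-LEVEL INEQUALITY is a THEOREM (`MixedPairBoundLevel`), hence `MixedPairLaw`

Cell `pub-zeta5` (HONEST FRAMING: systematic search; no irrationality claim unless certified), TRACK «DENOM-LAW» D1
prover seat (denom-prover-d1 g11, `HOME/denom-law/prover-d1/ATTEMPT-11.md`).  Discharges BY NAME gen-2 g9's pure class-combinatorics
statement `ClusterValuation.MixedPairBoundLevel` (`Zeta5Search/MixedPairs.lean`; OBSERVED 97,844/97,844, «paper proof not written»):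
for a multipole class `x` and a single-pole class `y` in the window, `refund − N_p ≤ 3 + E_x + ν_y + palUnit_x`.

PROOF (integer bookkeeping on the seven nested blocks; the landed floor machinery does the work).
* `ν_y ≥ −1`: Lemma V1 (`classExpLowerBound_holds`, `E_x ≥ −N_p − 1`) and `refund ≤ 1`.
* `ν_y ≤ −2`: then `y` is NOT tame, so `ν_y = E_y`, and its pole `q` has a neutral class point `s₀ < q` below it.
  - `E_x ≥ −2`: Lemma V2's floor bound (`singlePoleExpBound_holds`, `netExp q ≥ −N_p`) and `E_y ≥ netExp q`.
  - `E_x ≤ −3`: (L1) `a_p ≥ depth(q) − 1 ≥ −netExp q ≥ −E_y` (every block through `q` other than the largest one is a top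
    partner: `topPartners_eq_card` + (F1)), and (L2) `law_W = refund_W + a_p − N_p ≤ T_x(3) = 3 + E_x + [palindromic ∧ 3 + E_x odd]`
    for EVERY multipole class (`lawW_le_classBound_three`: the tree's `lawW_le_classBound_multi` when `x` has
    a pole of order `≥ 3`; otherwise every class point off the even centre has depth `≤ 3`, at most ONE further block is met twice,
    a second further block can only hold the even centre, and the charging of `FloorInequalityWProof` closes with the palindromic pair
    `(−2,−2)` as the only tight shape — where the bonus pays); finally `refund ≤ refund_W` and, at `E_x ≤ −3`, the `W`-bonus forces
    `palUnit_x = 1` (`E_x` even and `≤ −3` is `≤ −4`).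
COROLLARIES: `mixedPairLaw_holds : MixedPairLaw` (through the landed `mixedPairLaw_of_boundLevel`) and
`casoratianValuationLaw_of_multiBlockLaw : MultiBlockLaw → CasoratianValuationLaw` — (CV) in the window now rests on the ONE
observed digit statement `MultiBlockLaw`.  `p`-adic bookkeeping of the cell's own rationals; nothing about irrationality.
-/

noncomputable section

open Finset

namespace Summit.KontsevichZagierPeriods.Zeta5Search.ClusterValuation

open Summit.KontsevichZagierPeriods.Zeta5Search.DualSeries (InBox)
open Summit.KontsevichZagierPeriods.Zeta5Search.CasoratianValuation
  (InPolytope pairFloors refund refundW topPartners CasoratianValuationLaw)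

/-! ### (L1) the blocks through a non-tame single pole are top partners -/

/-- **(L1)**: if the class of `y` contains a pole `q` and a NEUTRAL class point `s₀ < q`, then `a_p ≥ depth(q) − 1`
(Lemma V2's mechanism: every block through `q` other than the largest block `B_{j₁} ∋ s₀, q` has `N_{j₁k} ≥ 1`). -/
theorem blockCount_sub_one_le_topPartners (b : ℕ → ℤ) (hb : InPolytope b) {p y q s₀ : ℕ} (hp : 0 < p)
    (hq : q ∈ classSet b p y) (hqpole : netExp b q < 0) (hs₀ : s₀ ∈ classSet b p y) (hs₀q : s₀ < q)
    (hneut : netExp b s₀ = 0) : (blockCount b q : ℤ) - 1 ≤ topPartners b p := by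
  have hbox : InBox b := hb.1
  obtain ⟨j₁, hj₁, j₂, _, hmin₁, _⟩ := exists_two_largest b
  have hj₁7 := mem_range.1 hj₁
  have hq2 := two_le_blockCount_of_pole b hqpole
  have hq1 : q ∈ blk b j₁ := mem_largest_of_blockCount b hbox hj₁ hmin₁ (by omega)
  have hs1 : s₀ ∈ blk b j₁ := by
    refine mem_largest_of_blockCount b hbox hj₁ hmin₁ ?_
    unfold netExp at hneut; split_ifs at hneut <;> omega
  have hn1 : 2 ≤ nB b p y j₁ := by
    unfold nB
    exact one_lt_card.2 ⟨s₀, mem_filter.2 ⟨hs₀, hs1⟩, q, mem_filter.2 ⟨hq, hq1⟩, by omega⟩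
  -- every other block through `q` is a top partner of `j₁`
  have hsub : ((range 7).erase j₁).filter (fun k => q ∈ blk b k) ⊆
      ((range 7).erase j₁).filter (fun k => 1 ≤ pairTerm b p j₁ k) := by
    intro k hk
    obtain ⟨hk1, hqk⟩ := mem_filter.1 hk
    have hk7 := mem_range.1 (mem_erase.1 hk1).2
    have hnk : 1 ≤ nB b p y k := by
      unfold nB; exact card_pos.2 ⟨q, mem_filter.2 ⟨hq, hqk⟩⟩
    have hF1 := floorFact1 (x := y) b hb hp hj₁7 hk7 (by omega) hnk
    have : (2 : ℤ) ≤ nB b p y j₁ := by exact_mod_cast hn1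
    have : (1 : ℤ) ≤ nB b p y k := by exact_mod_cast hnk
    exact mem_filter.2 ⟨hk1, by omega⟩
  have hcount : (((range 7).erase j₁).filter (fun k => q ∈ blk b k)).card = blockCount b q - 1 := by
    rw [blockCount_eq]
    have : ((range 7).erase j₁).filter (fun k => q ∈ blk b k) = ((range 7).filter fun k => q ∈ blk b k).erase j₁ := by
      ext k; simp only [mem_filter, mem_erase]; tauto
    rw [this, card_erase_of_mem (mem_filter.2 ⟨hj₁, hq1⟩)]
  rw [topPartners_eq_card b hp hj₁ hmin₁]
  have h := card_le_card hsub
  rw [hcount] at h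
  have h' : ((blockCount b q - 1 : ℕ) : ℤ) ≤ ((((range 7).erase j₁).filter fun k => 1 ≤ pairTerm b p j₁ k).card : ℤ) := by
    exact_mod_cast h
  have hq1' : 1 ≤ blockCount b q := by omega
  push_cast [Nat.cast_sub hq1'] at h'
  exact h'

/-! ### The theorem and its corollaries -/

/-- **`MixedPairBoundLevel` (gen-2 g9) is a theorem [conjecture node discharged, by name, hypothesis-free]**: for a multipole class `x`
and a single-pole class `y` in the window `5 ≤ p ≤ b₀ < p² − 2`, `refund − N_p ≤ 3 + E_x + ν_y + palUnit_x`.  HONEST FRAMING: integer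
bookkeeping on the cell's own class data; nothing about irrationality. -/
theorem mixedPairBoundLevel_holds : MixedPairBoundLevel := by
  intro b p x y hb hprime hp5 hpb hwin hx hy hmulti hone
  have hodd : ¬ 2 ∣ p := by
    intro h2
    rcases hprime.eq_one_or_self_of_dvd 2 h2 with h | h <;> omega
  have hp : 0 < p := by omega
  have hr1 : refund b p ≤ 1 := min_le_left _ _
  have hpal0 : 0 ≤ palUnit b p x := by unfold palUnit; split_ifs <;> norm_num
  have hV1 := classExpLowerBound_holds b p x hb hp5 hodd hpb hwin hx hmulti
  by_cases hν : -1 ≤ classNu b p y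
  · linarith
  push Not at hν
  -- `y` is not tame, so `ν_y = E_y`
  have ht : ¬ tameSingle b p y = true := by
    intro ht
    unfold classNu at hν
    rw [if_pos ⟨hone, ht⟩] at hν
    have := le_max_right (classExp b p y) 0
    linarith
  have hνE : classNu b p y = classExp b p y := by
    unfold classNu; rw [if_neg (fun h => ht h.2)]
  -- the pole `q` of `y` and a neutral class point `s₀ < q`
  obtain ⟨q, hq⟩ := card_pos.1 (by unfold classPoleCount at hone; omega :
    0 < ((classSet b p y).filter fun s => netExp b s < 0).card)
  rw [mem_filter] at hq
  have hnt : ¬ (q < p ∨ ∀ s ∈ classSet b p y, s < q → 0 < netExp b s) := by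
    intro h
    apply ht
    unfold tameSingle
    rw [decide_eq_true_eq]
    exact ⟨q, hq.1, hq.2, h⟩
  push Not at hnt
  obtain ⟨-, s₀, hs₀, hs₀q, hs₀le⟩ := hnt
  have huniq : ∀ s ∈ classSet b p y, s ≠ q → 0 ≤ netExp b s := by
    intro s hs hsq
    by_contra hneg
    push Not at hneg
    have : 2 ≤ classPoleCount b p y := by
      unfold classPoleCount
      exact one_lt_card.2 ⟨s, mem_filter.2 ⟨hs, hneg⟩, q, mem_filter.2 ⟨hq.1, hq.2⟩, hsq⟩
    omega
  have hs₀0 : netExp b s₀ = 0 := le_antisymm hs₀le (huniq s₀ hs₀ (by omega))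
  -- `E_y ≥ netExp q`
  have hEy : netExp b q ≤ classExp b p y := by
    unfold classExp
    have hrest : 0 ≤ ∑ s ∈ (classSet b p y).erase q, netExp b s :=
      sum_nonneg fun s hs => huniq s (mem_of_mem_erase hs) (ne_of_mem_erase hs)
    have hsum := add_sum_erase (classSet b p y) (fun s => netExp b s) hq.1
    have hc : 0 ≤ (if ¬ (2 : ℤ) ∣ b 0 ∧ CentreIn b p y then (1 : ℤ) else 0) := by split_ifs <;> norm_num
    linarith
  have hV2 := singlePoleExpBound_holds b p y q s₀ hb hp5 hodd hpb hwin hy hone hq.1 hq.2 hs₀ hs₀q hs₀0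
  by_cases hEx : -2 ≤ classExp b p x
  · rw [hνE]; linarith
  push Not at hEx
  -- `E_x ≤ −3`: (L1) + (L2)
  have hL2 := lawW_le_classBound_three b hb hp5 hmulti
  have hL1 := blockCount_sub_one_le_topPartners b hb hp hq.1 hq.2 hs₀ hs₀q hs₀0
  have hnq : 1 - (blockCount b q : ℤ) ≤ netExp b q := by
    unfold netExp; split_ifs <;> omega
  have hrr : refund b p ≤ refundW b p := by
    unfold refund refundW
    exact min_le_min le_rfl (Int.ediv_le_ediv (by exact_mod_cast hp) (by linarith))
  unfold classBound at hL2
  rw [if_pos hmulti] at hL2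
  unfold lawW at hL2
  -- at `E_x ≤ −3` the `W`-bonus implies the palindromic unit
  have hbonus : (if IsPalindromic (classConfig b p x) ∧ Odd (((3 : ℕ) : ℤ) + classExp b p x) then (1 : ℤ) else 0)
      ≤ palUnit b p x := by
    split_ifs with h1
    · obtain ⟨hpal, hodd3⟩ := h1
      have h3 : Odd ((3 : ℤ) + classExp b p x) := by simpa using hodd3
      have hev : Even (classExp b p x) := (Int.odd_add.1 h3).1 (by decide)
      have h4 : classExp b p x ≤ -4 := by obtain ⟨r, hr⟩ := hev; omega
      unfold palUnit
      rw [if_pos ⟨hpal, hev, h4⟩]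
    · exact hpal0
  rw [hνE]
  push_cast at hL2 hbonus ⊢
  linarith

/-- **`MixedPairLaw` (gen-2 g9) is a theorem [conjecture node discharged, by name, hypothesis-free]**: every mixed pair of the `𝒦`-bracket
reaches the (CV-𝒦) target `refund − N_p` (the landed reduction `mixedPairLaw_of_boundLevel` applied to `mixedPairBoundLevel_holds`).  HONEST
FRAMING: `p`-adic valuations of the cell's own rationals; nothing about irrationality. -/
theorem mixedPairLaw_holds : MixedPairLaw := mixedPairLaw_of_boundLevel mixedPairBoundLevel_holds

/-- **(CV) ⇐ `MultiBlockLaw` alone**: the Casoratian valuation law at every window prime now rests on the single OBSERVED digit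
statement about the multipole block. -/
theorem casoratianValuationLaw_of_multiBlockLaw (hM : MultiBlockLaw) : CasoratianValuationLaw :=
  casoratianValuationLaw_of_multiBlock_boundLevel hM mixedPairBoundLevel_holds

end Summit.KontsevichZagierPeriods.Zeta5Search.ClusterValuation

end
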